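import Mathlib
import HarnessLib
import Summits.CriticalPhenomena.CardyFormulaZ2.Theses.CardySusyWard
import Summits.CriticalPhenomena.CardyFormulaZ2.Theses.CardyComplexCone
import Summits.CriticalPhenomena.CardyFormulaZ2.Theorems.ParafermionPrecompact.Negative.ParafermionPrecompactFalseOfBulkNondegenerate
import Literature.Probability.LatticeModels.DartPhase

/-!
# Line `four-class-vertex-transfer` for the crux `CardySusyWard.ParafermionPrecompact`
(item stmt-CriticalPhenomena-11293) — CHECKED SKELETON (crux-plan, round 1)

Idea (card `Cruxes/ParafermionPrecompact/Ideas/four-class-vertex-transfer.md`, triage r1: 3 × pass,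
"glue, thin; M-sized reduction; blocked-on 11387 by design"): at a genuine medial vertex `z` of
`δℤ²` that is not one of the two marked boundary edges, the spin-`1/3` VERTEX passage phase of the
exploration interface (mid-turn winding `windingAt = (W_in + W_out)/2`, consecutive darts
perpendicular, `W_out = W_in ± π/2`) is the fixed real multiple `1/(2 cos(π/12))` of the sum of the
incoming and the outgoing DART phases; summing over the passages through `z` and regrouping by the
four corners (medial edges) at `z` gives, PATHWISE,
`2cos(π/12) · passageSum γ δ (1/3) z = Σ_{4 corners c at z} dartPhaseSum γ δ (1/3) c`
(`Sig.stub_fourCornerSplit`, the lever). Integrating (`Sig.stub_dartPhaseIntegrable`) turns the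
vertex observable `F_δ(z)` of this crux into `(2cos(π/12))⁻¹ Σ_{4 corners}` of the dart observable
of the twin crux `CardyComplexCone.EdgePrecompact` (stmt-CriticalPhenomena-11387, the transfer
target C⁺, registered here BY NAME as `stub_edgePrecompact`, the hardest stub). The four corners at
a horizontal and at a vertical medial vertex carry the same four classes `f - v ∈ {0,-e₀,-e₀-e₁,-e₁}`
(pairing `partner`; `class_partner`), so clause (ii) of the repaired crux only ever compares
SAME-CLASS darts and follows from the class-by-class clause (ii) of `EdgePrecompact` on a
`ρ`-thickening of `K`; clause (i) is the triangle inequality (constant `4C/(2cos(π/12))`). No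
cross-class input (`EdgeCoherence`) is used.

## What this skeleton concludes, and why (READ FIRST)

The crux AS TYPED (route file rev 5) is, kernel-checked, the NEGATION of the bulk non-degeneracy
`H = Literature.Probability.LatticeModels.ParafermionBulkNondegenerate` of the `q = 1` parafermion
(`Negative.parafermionPrecompact_iff_not_bulkNondegenerate`, p74235; five concurring refuter
certificates on the item; retriage note "Tenure: --restate with edge guards"): its clauses quantify
`z z'` over ALL of `Sym2 (Site 2)` and the junk twins collapse (ii) to vanishing. `H` is the weakest
consequence of DCS 2012 Conj. 8.7 — the conjecture this route sets out to prove — so NO true stub set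
can conclude the rev-5 decl by name; a skeleton doing so would need a believed-false stub (costume).
This file therefore concludes the REPAIRED crux named by the standing disprover (Disproof.lean §5,
"Restate 11293 as `∀ D Λ, ParafermionPrecompactRepairedAt D Λ`"):

  `parafermionPrecompactRepairedAt_of :
     Sig.stub_fourCornerSplit → Sig.stub_dartPhaseIntegrable → EdgePrecompact →
       ∀ D Λ, Negative.ParafermionPrecompactRepairedAt D Λ`            (real proof, no sorry)

and is registered with `ledger skeleton check … --crux stmt-CriticalPhenomena-11293 --crux-decl
Summit.CriticalPhenomena.CardyFormulaZ2.Theorems.ParafermionPrecompact.Negative.ParafermionPrecompactRepairedAt`.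
For the tenure planner's restatement the guarded text is spelt out verbatim as
`ParafermionPrecompactGuarded` (the rev-5 text with `z ∈ (zdGraph 2).edgeSet →` inserted in (i) and
`z ∈ … → z' ∈ … →` in (ii), = the refuters' `Repaired.lean`), with `guarded_iff_repairedAt` and
`parafermionPrecompactGuarded_of`: once 11293 is restated with that text (same decl name or
`ParafermionPrecompactR`), `theorem ParafermionPrecompact_of … := parafermionPrecompactGuarded_of`
retargets this skeleton by `Iff.rfl`-level unfolding. Until then every line of this crux is in the
same position (TRIAGE r1-1 §0, r1-2 preamble, r1-3 preamble).

Disproof honoured: `parafermionPrecompact_iff_vanishing` / `_iff_not_bulkNondegenerate` (we do NOT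
conclude the typed text; `typedCrux_iff_not_H` below re-exports the obstruction);
`repaired_of_parafermionPrecompact` (C′ is a weakening: `guarded_of_typed`);
`mem_edgeSet_of_mem_medialExploration` / `exists_eq_mk_add_single` (genuine medial vertices are
`s(x, x + eᵢ)`, used at `hz` in both clauses); `medialPoint_injOn_edgeSet` (under the guards the
twin witness is gone — the composition never compares a vertex with a junk pair). Negatives 6949 /
0772 (junk typing, eventual-in-δ): every statement below is edge-guarded or pathwise, and eventual.

Imports: the two route files, the landed Negative file (vocabulary `F`, `IsFamily`,
`ParafermionPrecompactRepairedAt`), `DartPhase` (`dartPhaseSum`, `bondDartObservable`,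
`norm_dartPhaseSum_le_one`). NOT imported: the barrier file `FKParafermionicHalfCauchyRiemann`
(it imports `FermionicObservable`, whose real constants `passageSum`/`windingAt`/`winding` would
shadow the `MedialWinding` aliases the route decls are written over); its `medialCornersAt` is
copied verbatim as `cornersAt` (equal by `rfl` in any file importing both).
-/

noncomputable section

namespace Summit.CriticalPhenomena.CardyFormulaZ2.Cruxes.ParafermionPrecompact.FourClassVertexTransfer

open scoped BigOperators Topology
open Filter Set MeasureTheory
open Literature.Probability.LatticeModels Literature.Probability.RandomPlanarGeometry
open Literature.Probability.Percolation (BondConfig bondPercolation half)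
open Summit.CriticalPhenomena.CardyFormulaZ2.Theorems.ParafermionPrecompact.Negative
open Summit.CriticalPhenomena.CardyFormulaZ2.Theses.CardyComplexCone (EdgePrecompact)

/-! ### The four corners (medial edges) at a genuine medial vertex -/

/-- The four corners `(v, f)` (medial edges; `v` a site, `f` a face indexed by its lower-left
corner) incident to the genuine medial vertex `s(x, x + eᵢ)`, listed clockwise `NW, NE, SE, SW`.
VERBATIM copy of `Literature.Barriers.CriticalPhenomena.medialCornersAt` (barrier file
`FKParafermionicHalfCauchyRiemann.lean`, certified there by `isCorner_medialCornersAt`,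
`cornerEdge_medialCornersAt`, `medialCornerOffset_eq`); not imported to keep `FermionicObservable`
out of the import closure (module docstring). -/
def cornersAt (x : Site 2) : Fin 2 → Fin 4 → Site 2 × Site 2
  | 0 => ![(x, x), (x + Pi.single 0 1, x), (x + Pi.single 0 1, x - Pi.single 1 1),
      (x, x - Pi.single 1 1)]
  | 1 => ![(x + Pi.single 1 1, x - Pi.single 0 1), (x + Pi.single 1 1, x), (x, x),
      (x, x - Pi.single 0 1)]

/-- Each of the four entries is a corner (`IsCorner v f`: `v ∈ f + {0,1}²`). -/
theorem isCorner_cornersAt (x : Site 2) (i : Fin 2) (k : Fin 4) :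
    IsCorner (cornersAt x i k).1 (cornersAt x i k).2 := by
  fin_cases i <;> fin_cases k <;> intro j <;> fin_cases j <;> simp [cornersAt]

/-- The site of each of the four corners at `s(x, x + eᵢ)` is an endpoint of that edge. -/
theorem fst_cornersAt (x : Site 2) (i : Fin 2) (k : Fin 4) :
    (cornersAt x i k).1 = x ∨ (cornersAt x i k).1 = x + Pi.single i 1 := by
  fin_cases i <;> fin_cases k <;> simp [cornersAt]

/-- The class pairing between the corners at a medial vertex of direction `i` and those at a medial
vertex of direction `i'`: the identity if `i = i'`, the half-turn `k ↦ k + 2` otherwise (the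
clockwise class lists are `0, -e₀, -e₀-e₁, -e₁` at a horizontal and `-e₀-e₁, -e₁, 0, -e₀` at a
vertical medial vertex). -/
def partner (i i' : Fin 2) (k : Fin 4) : Fin 4 := if i = i' then k else k + 2

/-- **Four-class incidence.** Paired corners have the same class `f - v` (so a vertex difference
never compares darts of different classes). -/
theorem class_partner (x x' : Site 2) (i i' : Fin 2) (k : Fin 4) :
    (cornersAt x i k).2 - (cornersAt x i k).1 =
      (cornersAt x' i' (partner i i' k)).2 - (cornersAt x' i' (partner i i' k)).1 := by
  fin_cases i <;> fin_cases i' <;> fin_cases k <;> simp [cornersAt, partner] <;> abel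

/-- Reindexing a sum over the four corners along the pairing. -/
theorem sum_partner (i i' : Fin 2) (g : Fin 4 → ℂ) :
    ∑ k, g (partner i i' k) = ∑ k, g k := by
  unfold partner
  split_ifs
  · rfl
  · exact Equiv.sum_comp (Equiv.addRight (2 : Fin 4)) g

/-! ### The corner (dart) observable of the twin crux `EdgePrecompact`, verbatim -/

/-- The phase functional of `CardyComplexCone.EdgePrecompact` at mesh `δ`, datum `E`, corner
`(v, f)`, configuration `ω` — VERBATIM the integrand of that crux with `Λ δ ↦ E` (so the bridge
`edgePrecompact_cornerObs` is definitional); it is `dartPhaseSum (medialExploration E ω) δ (1/3)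
(v, f)` of `DartPhase.lean` (`cornerPhase_eq_dartPhaseSum`). -/
def cornerPhase (δ : ℝ) (E : DiscreteDobrushin) (v f : Site 2) (ω : BondConfig (Site 2)) : ℂ :=
  (let γ := Literature.Probability.LatticeModels.medialExploration E ω; ∑ k ∈ (Finset.range γ.length).filter (fun k => γ[k]? = some (Literature.Probability.LatticeModels.cornerSource v f) ∧ γ[k + 1]? = some (Literature.Probability.LatticeModels.cornerTarget v f)), Complex.exp (-(Complex.I / 3) * ((Literature.Probability.LatticeModels.winding ((γ.map (Literature.Probability.LatticeModels.medialPoint δ)).take (k + 2)) : ℝ) : ℂ)))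

/-- The corner observable `E(v, f)` of `EdgePrecompact` at mesh `δ` for the datum `E`. -/
def cornerObs (δ : ℝ) (E : DiscreteDobrushin) (v f : Site 2) : ℂ :=
  ∫ ω, cornerPhase δ E v f ω ∂(bondPercolation (zdGraph 2) half)

/-- The crux integrand is the named dart phase sum of `DartPhase.lean` (only the spelling of the
exponent `-(i/3)·W` versus `-i·(1/3)·W` differs). -/
theorem cornerPhase_eq_dartPhaseSum (δ : ℝ) (E : DiscreteDobrushin) (v f : Site 2)
    (ω : BondConfig (Site 2)) :
    cornerPhase δ E v f ω = dartPhaseSum (medialExploration E ω) δ (1 / 3) (v, f) := by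
  unfold cornerPhase Parafermion.dartPhaseSum
  refine Finset.sum_congr rfl fun k _ => ?_
  congr 1
  push_cast
  ring

/-- The corner observable is the named dart observable `bondDartObservable E δ (1/3) (v, f)`. -/
theorem cornerObs_eq_bondDartObservable (δ : ℝ) (E : DiscreteDobrushin) (v f : Site 2) :
    cornerObs δ E v f = bondDartObservable E δ (1 / 3) (v, f) := by
  simp only [cornerObs, cornerPhase_eq_dartPhaseSum, Parafermion.bondDartObservable_def]

/-- **Bridge to the twin crux (definitional).** `EdgePrecompact` read over `cornerObs`. -/
theorem edgePrecompact_cornerObs (hEP : EdgePrecompact) (D : DobrushinDomain)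
    (Λ : ℝ → DiscreteDobrushin) (hΩ : ∀ δ, (Λ δ).Ω = D.carrier) (hδ : ∀ δ, (Λ δ).δ = δ)
    (hadm : ∀ᶠ δ in 𝓝[>] (0:ℝ), (Λ δ).IsZdAdmissible) (K : Set ℂ) (hK : IsCompact K)
    (hKD : K ⊆ D.carrier) :
    (∃ C : ℝ, ∀ᶠ δ in 𝓝[>] (0:ℝ), ∀ v f : Site 2, IsCorner v f → meshPoint δ v ∈ K →
        ‖cornerObs δ (Λ δ) v f‖ ≤ C * δ ^ ((1:ℝ) / 3)) ∧
      (∀ ε > (0:ℝ), ∃ η > (0:ℝ), ∀ᶠ δ in 𝓝[>] (0:ℝ), ∀ v f v' f' : Site 2,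
        IsCorner v f → IsCorner v' f' → f - v = f' - v' → meshPoint δ v ∈ K →
          meshPoint δ v' ∈ K → dist (meshPoint δ v) (meshPoint δ v') < η →
            ‖cornerObs δ (Λ δ) v f - cornerObs δ (Λ δ) v' f'‖ ≤ ε * δ ^ ((1:ℝ) / 3)) :=
  hEP D Λ hΩ hδ hadm K hK hKD

/-! ### The three registered stubs

Each stub's statement is the `Prop` `Sig.stub_<name>`; the registered obligation is
`theorem stub_<name> : Sig.stub_<name> := by sorry` (resp. `stub_edgePrecompact : EdgePrecompact`);
the composition takes the statements as hypotheses BY NAME. -/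

/-- STUB 1 — **FOUR-CORNER SPLIT** (the lever; pathwise; size M). For every discrete Dobrushin
datum `E` (admissible or not — the junk exploration `[]` gives `0 = 0`), every mesh `δ > 0` (at
`δ = 0` all medial points coincide and the identity is false), every configuration `ω`, and every
genuine medial vertex `z = s(x, x + eᵢ)` that is NOT one of the marked boundary edges of `E`:
`2cos(π/12) · passageSum γ δ (1/3) z = Σ_{k < 4} dartPhaseSum γ δ (1/3) (cornersAt x i k)`,
`γ = medialExploration E ω`. Content: (a) `γ` is `[]` or an `IsMedialExploration` (junk branch /
`dif_pos`; no named fact), whose `head`/`getLast` lie in `E.zdABEdges`, so every passage through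
`z` is at an interior position `0 < k < |γ| - 1`; (b) VERTEX/DART SPLIT: consecutive darts of an
exploration are perpendicular (`IsMedialTurn`: the two corners share `v` — counter-clockwise
quarter turn — or share `f` — clockwise quarter turn; `medialPoint_cornerTarget_sub_cornerSource`),
so `winding (take (k+2)) = winding (take (k+1)) ± π/2` and
`2cos(π/12)·e^{-(i/3)·windingAt γ δ k} = e^{-(i/3) W(take (k+1))} + e^{-(i/3) W(take (k+2))}`
(`(e^{-ia} + e^{-ib}) = 2 e^{-i(a+b)/2} cos((a-b)/2)`; the ideator's `VertexDartSplit`, triage-verified);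
(c) REGROUPING: the incoming dart `(γ[k-1], z)` is a medial step, hence the dart of a corner
`(v, f)` with `cornerTarget v f = z`, and the only such corners are two of `cornersAt x i` (`NE`,
`SW` for `i = 0`); likewise the outgoing dart is one of the two corners with `cornerSource = z`
(`NW`, `SE`); summing over passages and exchanging sums gives the identity (multiplicities are
irrelevant; `nodup` is not needed). Why it might fail: only through a convention slip
(`cornerSource`/`cornerTarget` orientation, the `take (k+1)`/`take (k+2)` indexing of `windingAt`,
sign of `arg`) — each checked by hand by the three triagers against `MedialWinding`/`DartPhase`;
a brute-force check over all explorations of a `3 × 3` admissible box is the cheapest falsifier. -/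
def Sig.stub_fourCornerSplit : Prop :=
  ∀ (E : DiscreteDobrushin) (δ : ℝ), 0 < δ → ∀ (ω : BondConfig (Site 2)) (x : Site 2) (i : Fin 2),
    s(x, x + Pi.single i 1) ∉ E.zdABEdges →
      ((2 * Real.cos (Real.pi / 12) : ℝ) : ℂ) *
          passageSum (medialExploration E ω) δ (1 / 3) s(x, x + Pi.single i 1) =
        ∑ k : Fin 4, dartPhaseSum (medialExploration E ω) δ (1 / 3) (cornersAt x i k)

/-- STUB 2 — **INTEGRABILITY OF THE DART PHASE** (size S–M). For an admissible datum the phase sum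
of the exploration along any dart is integrable under `P_{1/2}`: it is bounded by `1`
(`norm_dartPhaseSum_le_one` with `nodup_zip_tail_medialExploration`, `DartPhase.lean`) and
measurable because the exploration is a measurable function of the configuration — for admissible
data this is `DiscreteDobrushin.measurable_explorationFiltration_comp_medialExploration_card`
(`FKExplorationClock.lean`, w.r.t. the exploration filtration, which is `≤` the ambient σ-algebra),
then `Integrable.mono'` against the constant `1`. (True for every datum — the level sets of
`medialExploration E` are countable Boolean combinations of cylinder events — but only the
admissible case is consumed.) Caveat for the prover: `FKExplorationClock`'s import closure may
contain `FermionicObservable`; write `MedialPath.passageSum` / `Parafermion.dartPhaseSum` explicitly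
in a file importing it. Why it might fail: it cannot (bounded cylinder functional); the only risk
is measurable-space plumbing. -/
def Sig.stub_dartPhaseIntegrable : Prop :=
  ∀ (E : DiscreteDobrushin), E.IsZdAdmissible → ∀ (δ σ : ℝ) (c : Site 2 × Site 2),
    Integrable (fun ω => dartPhaseSum (medialExploration E ω) δ σ c) (bondPercolation (zdGraph 2) half)

/-- Registered stub 1 (four-corner split — the lever). -/
theorem stub_fourCornerSplit : Sig.stub_fourCornerSplit := by
  sorry

/-- Registered stub 2 (integrability of the dart phase for admissible data). -/
theorem stub_dartPhaseIntegrable : Sig.stub_dartPhaseIntegrable := by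
  sorry

/-- Registered stub 3 — **THE TRANSFER TARGET C⁺ = the twin crux `CardyComplexCone.EdgePrecompact`
BY NAME** (stmt-CriticalPhenomena-11387; XL, open; the HARDEST stub: per-class bound and
same-class equicontinuity of `δ^{-1/3}`·(dart observable), i.e. tightness of the DCS normalisation
at `σ = 1/3` — it has its own crux directory with three triage-passing lines
`Cruxes/EdgePrecompact/Lines/*` and a picked lead; this line is `blocked-on: 11387` by design and
is discharged by `exact` from the theorem closing 11387). Why it might fail: the sharp `1/3`
itself (two-arm `δ^{1/4}` a-priori bound, missing `δ^{1/12}` winding-phase cancellation on `ℤ²`). -/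
theorem stub_edgePrecompact : EdgePrecompact := by
  sorry

/-! ### Glue lemmas (elementary, proved) -/

/-- `2 cos(π/12) > 0`. -/
theorem splitConst_pos : 0 < 2 * Real.cos (Real.pi / 12) := by
  have h : 0 < Real.cos (Real.pi / 12) := by
    apply Real.cos_pos_of_mem_Ioo
    constructor <;> linarith [Real.pi_pos]
  linarith

/-- `Site.toComplex` is additive. -/
theorem toComplex_add (x y : Site 2) :
    Site.toComplex (x + y) = Site.toComplex x + Site.toComplex y := by
  apply Complex.ext <;> simp [Site.toComplex]

/-- The unit lattice vectors have unimodular complex images (`1` and `i`). -/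
theorem norm_toComplex_single (i : Fin 2) : ‖Site.toComplex (Pi.single i (1:ℤ) : Site 2)‖ = 1 := by
  fin_cases i
  · have : Site.toComplex (Pi.single (0 : Fin 2) (1:ℤ) : Site 2) = 1 := by
      apply Complex.ext <;> simp [Site.toComplex]
    simp [this]
  · have : Site.toComplex (Pi.single (1 : Fin 2) (1:ℤ) : Site 2) = Complex.I := by
      apply Complex.ext <;> simp [Site.toComplex]
    simp [this]

/-- An endpoint of a lattice edge is at distance `δ/2` from its midpoint (mesh `δ ≥ 0`). -/
theorem dist_endpoint_medialPoint {δ : ℝ} (hδ : 0 ≤ δ) (x v : Site 2) (i : Fin 2)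
    (hv : v = x ∨ v = x + Pi.single i 1) :
    dist (meshPoint δ v) (medialPoint δ s(x, x + Pi.single i 1)) = δ / 2 := by
  have key : ∀ w : ℂ, ‖w‖ = 1 → ‖(δ : ℂ) * w / 2‖ = δ / 2 := fun w hw => by
    rw [norm_div, norm_mul, Complex.norm_real, Real.norm_eq_abs, abs_of_nonneg hδ, hw,
      RCLike.norm_ofNat]
    ring
  rw [dist_eq_norm, medialPoint_mk]
  rcases hv with rfl | rfl
  · have : meshPoint δ v - (meshPoint δ v + meshPoint δ (v + Pi.single i 1)) / 2 =
        -((δ : ℂ) * Site.toComplex (Pi.single i (1:ℤ) : Site 2) / 2) := by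
      simp only [meshPoint, toComplex_add]
      ring
    rw [this, norm_neg, key _ (norm_toComplex_single i)]
  · have : meshPoint δ (x + Pi.single i 1) - (meshPoint δ x + meshPoint δ (x + Pi.single i 1)) / 2 =
        (δ : ℂ) * Site.toComplex (Pi.single i (1:ℤ) : Site 2) / 2 := by
      simp only [meshPoint, toComplex_add]
      ring
    rw [this, key _ (norm_toComplex_single i)]

/-- The site of every corner at `s(x, x + eᵢ)` is within `δ/2` of the medial point. -/
theorem dist_fst_cornersAt_medialPoint {δ : ℝ} (hδ : 0 ≤ δ) (x : Site 2) (i : Fin 2) (k : Fin 4) :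
    dist (meshPoint δ (cornersAt x i k).1) (medialPoint δ s(x, x + Pi.single i 1)) = δ / 2 :=
  dist_endpoint_medialPoint hδ x _ i (fst_cornersAt x i k)

/-- **The marked edges leave every compact eventually.** Under the marks hypothesis of the family
(discrete marked points → `{a, b}` in Hausdorff distance), for a compact `K ⊆ Ω` (open), eventually
in `δ` no `A`–`B` edge of `Λ δ` has its medial point in `K` (`a, b ∈ ∂Ω` are at positive distance
from `K`). -/
theorem eventually_forall_zdABEdges_not_mem (D : DobrushinDomain) (Λ : ℝ → DiscreteDobrushin)
    (hmarks : Tendsto (fun δ : ℝ => Metric.hausdorffEDist (medialPoint δ '' (Λ δ).zdABEdges)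
      {D.pt 0, D.pt 1}) (𝓝[>] 0) (𝓝 0))
    {K : Set ℂ} (hK : IsCompact K) (hKD : K ⊆ D.carrier) :
    ∀ᶠ δ in 𝓝[>] (0:ℝ), ∀ z ∈ (Λ δ).zdABEdges, medialPoint δ z ∉ K := by
  rcases K.eq_empty_or_nonempty with rfl | hKne
  · exact Filter.Eventually.of_forall fun δ z _ h => h
  have hpt : ∀ i : Fin 2, D.pt i ∉ K := fun i hi => by
    have hfr := D.pt_mem_frontier i
    rw [D.isOpen.frontier_eq] at hfr
    exact hfr.2 (hKD hi)
  have hr : ∀ i : Fin 2, 0 < Metric.infDist (D.pt i) K := fun i =>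
    (hK.isClosed.notMem_iff_infDist_pos hKne).1 (hpt i)
  set r : ℝ := min (Metric.infDist (D.pt 0) K) (Metric.infDist (D.pt 1) K) with hrdef
  have hr0 : 0 < r := lt_min (hr 0) (hr 1)
  have hri : ∀ i : Fin 2, r ≤ Metric.infDist (D.pt i) K := fun i => by
    fin_cases i
    · exact min_le_left _ _
    · exact min_le_right _ _
  have hev : ∀ᶠ δ in 𝓝[>] (0:ℝ),
      Metric.hausdorffEDist (medialPoint δ '' (Λ δ).zdABEdges) {D.pt 0, D.pt 1} <
        ENNReal.ofReal r :=
    (tendsto_order.1 hmarks).2 _ (ENNReal.ofReal_pos.2 hr0)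
  filter_upwards [hev] with δ hδ z hz hzK
  have h1 : Metric.infEDist (medialPoint δ z) {D.pt 0, D.pt 1} < ENNReal.ofReal r :=
    lt_of_le_of_lt (Metric.infEDist_le_hausdorffEDist_of_mem (Set.mem_image_of_mem _ hz)) hδ
  obtain ⟨p, hp, hpz⟩ := Metric.infEDist_lt_iff.1 h1
  rw [edist_lt_ofReal] at hpz
  have key : ∀ i : Fin 2, p = D.pt i → False := fun i hpi => by
    have hle : Metric.infDist (D.pt i) K ≤ dist (D.pt i) (medialPoint δ z) :=
      Metric.infDist_le_dist_of_mem hzK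
    rw [hpi, dist_comm] at hpz
    linarith [hri i]
  rcases hp with hp | hp
  · exact key 0 hp
  · exact key 1 hp

/-- **The observable identity** (stubs 1–2 integrated): for an admissible datum `Λ δ`, mesh
`δ > 0` and a genuine, unmarked medial vertex `s(x, x + eᵢ)`,
`2cos(π/12) · F_δ(z) = Σ_{k<4} cornerObs δ (Λ δ) (cornersAt x i k)`. -/
theorem splitConst_mul_F_eq (hSplit : Sig.stub_fourCornerSplit) (hInt : Sig.stub_dartPhaseIntegrable)
    (Λ : ℝ → DiscreteDobrushin) {δ : ℝ} (hadm : (Λ δ).IsZdAdmissible) (hδ : 0 < δ) (x : Site 2)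
    (i : Fin 2) (hz : s(x, x + Pi.single i 1) ∉ (Λ δ).zdABEdges) :
    ((2 * Real.cos (Real.pi / 12) : ℝ) : ℂ) * F Λ δ s(x, x + Pi.single i 1) =
      ∑ k : Fin 4, cornerObs δ (Λ δ) (cornersAt x i k).1 (cornersAt x i k).2 := by
  have hint : ∀ k : Fin 4, Integrable (fun ω => dartPhaseSum (medialExploration (Λ δ) ω) δ (1 / 3)
      (cornersAt x i k)) (bondPercolation (zdGraph 2) half) :=
    fun k => hInt (Λ δ) hadm δ (1 / 3) (cornersAt x i k)
  unfold F
  rw [← integral_const_mul]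
  simp only [cornerObs_eq_bondDartObservable, Parafermion.bondDartObservable_def]
  rw [← integral_finsetSum _ fun k _ => hint k]
  refine integral_congr_ae (Filter.Eventually.of_forall fun ω => ?_)
  exact hSplit (Λ δ) δ hδ ω x i hz

/-! ### The composition: the three stubs give the REPAIRED crux `C′` BY NAME -/

/-- **The line.** Four-corner split + integrability of the dart phase + the twin crux
`EdgePrecompact` imply the repaired crux `∀ D Λ, ParafermionPrecompactRepairedAt D Λ`
(clause (i): triangle inequality with constant `4C/(2cos(π/12))` on the `ρ`-thickening of `K`;
clause (ii): same-class pairing, `ε' = ε·2cos(π/12)/4`, `η = η'/2`, meshes `δ < min ρ (η'/2)`). -/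
theorem parafermionPrecompactRepairedAt_of :
    Sig.stub_fourCornerSplit → Sig.stub_dartPhaseIntegrable → EdgePrecompact →
      ∀ (D : DobrushinDomain) (Λ : ℝ → DiscreteDobrushin), ParafermionPrecompactRepairedAt D Λ := by
  intro hSplit hInt hEP D Λ hfam K hK hKD
  obtain ⟨hΩ, hδ, _hA, _hB, hmarks, hadm⟩ := hfam
  -- an inner collar for K: the sites of the corners at a vertex in K lie in K' = cthickening ρ K
  obtain ⟨ρ, hρ, hρK⟩ := hK.exists_cthickening_subset_open D.isOpen hKD
  have hK' : IsCompact (Metric.cthickening ρ K) := hK.cthickening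
  obtain ⟨⟨C, hC⟩, hii⟩ :=
    edgePrecompact_cornerObs hEP D Λ hΩ hδ hadm (Metric.cthickening ρ K) hK' hρK
  have hκ : 0 < 2 * Real.cos (Real.pi / 12) := splitConst_pos
  -- eventualities in δ
  have hpos : ∀ᶠ δ in 𝓝[>] (0:ℝ), 0 < δ := eventually_mem_nhdsWithin
  have hltρ : ∀ᶠ δ in 𝓝[>] (0:ℝ), δ < ρ := (eventually_lt_nhds hρ).filter_mono nhdsWithin_le_nhds
  have hoff : ∀ᶠ δ in 𝓝[>] (0:ℝ), ∀ z ∈ (Λ δ).zdABEdges, medialPoint δ z ∉ K :=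
    eventually_forall_zdABEdges_not_mem D Λ hmarks hK hKD
  -- sites of corners at a vertex of K lie in the collar once δ < ρ
  have hcollar : ∀ (δ : ℝ), 0 < δ → δ < ρ → ∀ (x : Site 2) (i : Fin 2) (k : Fin 4),
      medialPoint δ s(x, x + Pi.single i 1) ∈ K →
        meshPoint δ (cornersAt x i k).1 ∈ Metric.cthickening ρ K := by
    intro δ hδ0 hδρ x i k hzK
    refine Metric.mem_cthickening_of_dist_le _ _ ρ K hzK ?_
    rw [dist_fst_cornersAt_medialPoint hδ0.le]
    linarith
  unfold ClauseBoundEdges ClauseEquicontEdges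
  refine ⟨⟨4 * C / (2 * Real.cos (Real.pi / 12)), ?_⟩, ?_⟩
  · -- clause (i)
    filter_upwards [hC, hadm, hpos, hltρ, hoff] with δ hCδ hadmδ hδ0 hδρ hoffδ
    intro z hz hzK
    obtain ⟨x, i, rfl⟩ := exists_eq_mk_add_single hz
    have hzm : s(x, x + Pi.single i 1) ∉ (Λ δ).zdABEdges := fun h => hoffδ _ h hzK
    have hid := splitConst_mul_F_eq hSplit hInt Λ hadmδ hδ0 x i hzm
    have hk : ∀ k : Fin 4, ‖cornerObs δ (Λ δ) (cornersAt x i k).1 (cornersAt x i k).2‖ ≤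
        C * δ ^ ((1:ℝ) / 3) :=
      fun k => hCδ _ _ (isCorner_cornersAt x i k) (hcollar δ hδ0 hδρ x i k hzK)
    have h1 : (2 * Real.cos (Real.pi / 12)) * ‖F Λ δ s(x, x + Pi.single i 1)‖ =
        ‖∑ k : Fin 4, cornerObs δ (Λ δ) (cornersAt x i k).1 (cornersAt x i k).2‖ := by
      rw [← hid, norm_mul, Complex.norm_real, Real.norm_eq_abs, abs_of_pos hκ]
    have h2 : ‖∑ k : Fin 4, cornerObs δ (Λ δ) (cornersAt x i k).1 (cornersAt x i k).2‖ ≤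
        4 * (C * δ ^ ((1:ℝ) / 3)) :=
      calc ‖∑ k : Fin 4, cornerObs δ (Λ δ) (cornersAt x i k).1 (cornersAt x i k).2‖
          ≤ ∑ k : Fin 4, ‖cornerObs δ (Λ δ) (cornersAt x i k).1 (cornersAt x i k).2‖ :=
            norm_sum_le _ _
        _ ≤ ∑ _k : Fin 4, C * δ ^ ((1:ℝ) / 3) := Finset.sum_le_sum fun k _ => hk k
        _ = 4 * (C * δ ^ ((1:ℝ) / 3)) := by simp
    rw [show 4 * C / (2 * Real.cos (Real.pi / 12)) * δ ^ ((1:ℝ) / 3) =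
        4 * (C * δ ^ ((1:ℝ) / 3)) / (2 * Real.cos (Real.pi / 12)) by ring]
    rw [le_div_iff₀ hκ]
    calc ‖F Λ δ s(x, x + Pi.single i 1)‖ * (2 * Real.cos (Real.pi / 12))
        = (2 * Real.cos (Real.pi / 12)) * ‖F Λ δ s(x, x + Pi.single i 1)‖ := mul_comm _ _
      _ = ‖∑ k : Fin 4, cornerObs δ (Λ δ) (cornersAt x i k).1 (cornersAt x i k).2‖ := h1
      _ ≤ 4 * (C * δ ^ ((1:ℝ) / 3)) := h2
  · -- clause (ii)
    intro ε hε
    obtain ⟨η', hη', hev⟩ := hii (ε * (2 * Real.cos (Real.pi / 12)) / 4) (by positivity)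
    refine ⟨η' / 2, by positivity, ?_⟩
    have hltη : ∀ᶠ δ in 𝓝[>] (0:ℝ), δ < η' / 2 :=
      (eventually_lt_nhds (by positivity : (0:ℝ) < η' / 2)).filter_mono nhdsWithin_le_nhds
    filter_upwards [hev, hadm, hpos, hltρ, hltη, hoff] with δ hevδ hadmδ hδ0 hδρ hδη hoffδ
    intro z z' hz hz' hzK hz'K hdist
    obtain ⟨x, i, rfl⟩ := exists_eq_mk_add_single hz
    obtain ⟨x', i', rfl⟩ := exists_eq_mk_add_single hz'
    have hzm : s(x, x + Pi.single i 1) ∉ (Λ δ).zdABEdges := fun h => hoffδ _ h hzK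
    have hzm' : s(x', x' + Pi.single i' 1) ∉ (Λ δ).zdABEdges := fun h => hoffδ _ h hz'K
    have hid := splitConst_mul_F_eq hSplit hInt Λ hadmδ hδ0 x i hzm
    have hid' := splitConst_mul_F_eq hSplit hInt Λ hadmδ hδ0 x' i' hzm'
    -- the paired same-class differences
    set b : Fin 4 → ℂ := fun k => cornerObs δ (Λ δ) (cornersAt x i k).1 (cornersAt x i k).2 with hb
    set b' : Fin 4 → ℂ := fun k => cornerObs δ (Λ δ) (cornersAt x' i' k).1 (cornersAt x' i' k).2
      with hb'
    have hk : ∀ k : Fin 4, ‖b k - b' (partner i i' k)‖ ≤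
        ε * (2 * Real.cos (Real.pi / 12)) / 4 * δ ^ ((1:ℝ) / 3) := by
      intro k
      refine hevδ _ _ _ _ (isCorner_cornersAt x i k) (isCorner_cornersAt x' i' _)
        (class_partner x x' i i' k) (hcollar δ hδ0 hδρ x i k hzK)
        (hcollar δ hδ0 hδρ x' i' _ hz'K) ?_
      calc dist (meshPoint δ (cornersAt x i k).1) (meshPoint δ (cornersAt x' i' (partner i i' k)).1)
          ≤ dist (meshPoint δ (cornersAt x i k).1) (medialPoint δ s(x, x + Pi.single i 1)) +
              dist (medialPoint δ s(x, x + Pi.single i 1)) (medialPoint δ s(x', x' + Pi.single i' 1)) +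
              dist (medialPoint δ s(x', x' + Pi.single i' 1))
                (meshPoint δ (cornersAt x' i' (partner i i' k)).1) := dist_triangle4 _ _ _ _
        _ = δ / 2 + dist (medialPoint δ s(x, x + Pi.single i 1))
              (medialPoint δ s(x', x' + Pi.single i' 1)) + δ / 2 := by
            rw [dist_fst_cornersAt_medialPoint hδ0.le, dist_comm (medialPoint δ _) (meshPoint δ _),
              dist_fst_cornersAt_medialPoint hδ0.le]
        _ < η' := by linarith
    have hsum : ((2 * Real.cos (Real.pi / 12) : ℝ) : ℂ) *
        (F Λ δ s(x, x + Pi.single i 1) - F Λ δ s(x', x' + Pi.single i' 1)) =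
          ∑ k : Fin 4, (b k - b' (partner i i' k)) := by
      rw [mul_sub, hid, hid', Finset.sum_sub_distrib, sum_partner i i' b']
    have h1 : (2 * Real.cos (Real.pi / 12)) *
        ‖F Λ δ s(x, x + Pi.single i 1) - F Λ δ s(x', x' + Pi.single i' 1)‖ =
          ‖∑ k : Fin 4, (b k - b' (partner i i' k))‖ := by
      rw [← hsum, norm_mul, Complex.norm_real, Real.norm_eq_abs, abs_of_pos hκ]
    have h2 : ‖∑ k : Fin 4, (b k - b' (partner i i' k))‖ ≤
        4 * (ε * (2 * Real.cos (Real.pi / 12)) / 4 * δ ^ ((1:ℝ) / 3)) :=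
      calc ‖∑ k : Fin 4, (b k - b' (partner i i' k))‖
          ≤ ∑ k : Fin 4, ‖b k - b' (partner i i' k)‖ := norm_sum_le _ _
        _ ≤ ∑ _k : Fin 4, ε * (2 * Real.cos (Real.pi / 12)) / 4 * δ ^ ((1:ℝ) / 3) :=
            Finset.sum_le_sum fun k _ => hk k
        _ = 4 * (ε * (2 * Real.cos (Real.pi / 12)) / 4 * δ ^ ((1:ℝ) / 3)) := by simp
    have h3 : (2 * Real.cos (Real.pi / 12)) *
        ‖F Λ δ s(x, x + Pi.single i 1) - F Λ δ s(x', x' + Pi.single i' 1)‖ ≤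
          (2 * Real.cos (Real.pi / 12)) * (ε * δ ^ ((1:ℝ) / 3)) := by
      rw [h1]
      calc ‖∑ k : Fin 4, (b k - b' (partner i i' k))‖
          ≤ 4 * (ε * (2 * Real.cos (Real.pi / 12)) / 4 * δ ^ ((1:ℝ) / 3)) := h2
        _ = (2 * Real.cos (Real.pi / 12)) * (ε * δ ^ ((1:ℝ) / 3)) := by ring
    exact le_of_mul_le_mul_left h3 hκ

/-- The skeleton in its final shape: the repaired crux BY NAME from the three registered stubs
(it depends on `sorryAx` only through the stubs). -/
theorem parafermionPrecompactRepairedAt_proof :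
    ∀ (D : DobrushinDomain) (Λ : ℝ → DiscreteDobrushin), ParafermionPrecompactRepairedAt D Λ :=
  parafermionPrecompactRepairedAt_of stub_fourCornerSplit stub_dartPhaseIntegrable stub_edgePrecompact

/-! ### The restatement text (for the tenure planner) and the relation to the typed decl -/

/-- **`C′` unfolded — the text to `--restate` stmt-CriticalPhenomena-11293 with**: the rev-5 text
VERBATIM with `z ∈ (zdGraph 2).edgeSet →` inserted after `∀ z : MedialVertex,` in clause (i) and
`z ∈ (zdGraph 2).edgeSet → z' ∈ (zdGraph 2).edgeSet →` after `∀ z z' : MedialVertex,` in clause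
(ii) (= the refuters' `Repaired.lean` on the item, = `∀ D Λ, Negative.ParafermionPrecompactRepairedAt
D Λ` with the family hypotheses curried: `guarded_iff_repairedAt`). -/
def ParafermionPrecompactGuarded : Prop :=
  ∀ (D : Literature.Probability.RandomPlanarGeometry.DobrushinDomain) (Λ : ℝ → Literature.Probability.LatticeModels.DiscreteDobrushin), (∀ δ, (Λ δ).Ω = D.carrier) → (∀ δ, (Λ δ).δ = δ) → Filter.Tendsto (fun δ : ℝ => Metric.hausdorffEDist (Λ δ).arcA (D.arc 0)) (nhdsWithin (0:ℝ) (Set.Ioi 0)) (nhds 0) → Filter.Tendsto (fun δ : ℝ => Metric.hausdorffEDist (Λ δ).arcB (D.arc 1)) (nhdsWithin (0:ℝ) (Set.Ioi 0)) (nhds 0) → Filter.Tendsto (fun δ : ℝ => Metric.hausdorffEDist (Literature.Probability.LatticeModels.medialPoint δ '' (Λ δ).zdABEdges) {D.pt 0, D.pt 1}) (nhdsWithin (0:ℝ) (Set.Ioi 0)) (nhds 0) → (∀ᶠ δ in nhdsWithin (0:ℝ) (Set.Ioi 0), (Λ δ).IsZdAdmissible) → ∀ K : Set ℂ, IsCompact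 K → K ⊆ D.carrier → (∃ C : ℝ, ∀ᶠ δ in nhdsWithin (0:ℝ) (Set.Ioi 0), ∀ z : Literature.Probability.LatticeModels.MedialVertex, z ∈ (Literature.Probability.LatticeModels.zdGraph 2).edgeSet → Literature.Probability.LatticeModels.medialPoint δ z ∈ K → ‖(∫ ω, Literature.Probability.LatticeModels.passageSum (Literature.Probability.LatticeModels.medialExploration (Λ δ) ω) δ (1 / 3) z ∂(Literature.Probability.Percolation.bondPercolation (Literature.Probability.LatticeModels.zdGraph 2) Literature.Probability.Percolation.half))‖ ≤ C * δ ^ ((1:ℝ) / 3)) ∧ (∀ ε > (0:ℝ), ∃ η > (0:ℝ), ∀ᶠ δ in nhdsWithin (0:ℝ) (Set.Ioi 0), ∀ z z' : Literature.Probability.LatticeModels.MedialVertex, z ∈ (Literature.Probability.LatticeModels.zdGraph 2).edgeSet → z' ∈ (Literature.Probability.LatticeModels.zdGraph 2).edgeSet → Literature.Probability.LatticeModels.medialPoint δ z ∈ K → Literature.Probability.LatticeModels.medialPoint δ z' ∈ K → dist (Literature.Probability.LatticeModels.medialPoint δ z) (Literature.Probability.LatticeModels.medialPoint δ z') < η →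 ‖(∫ ω, Literature.Probability.LatticeModels.passageSum (Literature.Probability.LatticeModels.medialExploration (Λ δ) ω) δ (1 / 3) z ∂(Literature.Probability.Percolation.bondPercolation (Literature.Probability.LatticeModels.zdGraph 2) Literature.Probability.Percolation.half)) - (∫ ω, Literature.Probability.LatticeModels.passageSum (Literature.Probability.LatticeModels.medialExploration (Λ δ) ω) δ (1 / 3) z' ∂(Literature.Probability.Percolation.bondPercolation (Literature.Probability.LatticeModels.zdGraph 2) Literature.Probability.Percolation.half))‖ ≤ ε * δ ^ ((1:ℝ) / 3))

/-- The curried guarded text is the disprover's `C′` (family hypotheses bundled/unbundled). -/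
theorem guarded_iff_repairedAt :
    ParafermionPrecompactGuarded ↔
      ∀ (D : DobrushinDomain) (Λ : ℝ → DiscreteDobrushin), ParafermionPrecompactRepairedAt D Λ := by
  constructor
  · intro h D Λ hfam K hK hKD
    exact h D Λ hfam.1 hfam.2.1 hfam.2.2.1 hfam.2.2.2.1 hfam.2.2.2.2.1 hfam.2.2.2.2.2 K hK hKD
  · intro h D Λ h1 h2 h3 h4 h5 h6 K hK hKD
    exact h D Λ ⟨h1, h2, h3, h4, h5, h6⟩ K hK hKD

/-- The line concludes the curried guarded text as well (what `ParafermionPrecompact_of` becomes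
after the restatement, by unfolding). -/
theorem parafermionPrecompactGuarded_of :
    Sig.stub_fourCornerSplit → Sig.stub_dartPhaseIntegrable → EdgePrecompact →
      ParafermionPrecompactGuarded :=
  fun h₁ h₂ h₃ => guarded_iff_repairedAt.2 (parafermionPrecompactRepairedAt_of h₁ h₂ h₃)

/-- Why this file does NOT conclude the rev-5 decl: AS TYPED the crux is the negation of bulk
non-degeneracy (Disproof §4, re-exported). -/
theorem typedCrux_iff_not_H :
    Theses.CardySusyWard.ParafermionPrecompact ↔ ¬ ParafermionBulkNondegenerate :=
  parafermionPrecompact_iff_not_bulkNondegenerate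

/-- … while the repaired crux (here in its curried spelling) is a weakening of it (Disproof §5,
`repaired_of_parafermionPrecompact`): nothing provable is lost by the restatement. (Stated over
`ParafermionPrecompactGuarded` so that the only theorems of this file concluding the audit target
`Negative.ParafermionPrecompactRepairedAt` by name are the skeleton `_of` / `_proof`.) -/
theorem guarded_of_typed (h : Theses.CardySusyWard.ParafermionPrecompact) :
    ParafermionPrecompactGuarded :=
  guarded_iff_repairedAt.2 (repaired_of_parafermionPrecompact h)

/-! ### Unregistered pointer for the prover of stub 1: the ideator's first lemma -/

/-- The vertex/dart split at one interior passage (the ideator's `VertexDartSplit`, verified by the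
three triagers; step (b) of `Sig.stub_fourCornerSplit`). NOT a registered obligation — a suggested
`--supports` helper. -/
def Aux.VertexDartSplit : Prop :=
  ∀ (E : DiscreteDobrushin) (ω : BondConfig (Site 2)) (δ : ℝ) (k : ℕ), 0 < δ →
    0 < k → k + 1 < (medialExploration E ω).length →
    let γ := medialExploration E ω
    let pts := γ.map (medialPoint δ)
    Complex.exp (-(Complex.I / 3) * (windingAt γ δ k : ℝ)) * (2 * Real.cos (Real.pi / 12) : ℝ) =
      Complex.exp (-(Complex.I / 3) * (Polyline.winding (pts.take (k + 1)) : ℝ)) +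
        Complex.exp (-(Complex.I / 3) * (Polyline.winding (pts.take (k + 2)) : ℝ))

end Summit.CriticalPhenomena.CardyFormulaZ2.Cruxes.ParafermionPrecompact.FourClassVertexTransfer

end
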